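import Summits.BirchSwinnertonDyer.BirchSwinnertonDyer.Theorems.KolyvaginRankRigidityAtTwoKolyvaginSwapConverses
import Summits.BirchSwinnertonDyer.BirchSwinnertonDyer.Theorems.KolyvaginRankRigidityAtTwoKolyvaginNonvanishingAtTwoFrameThetaOfStrongSystem
import HarnessLib

/-!
# Crux U1 `KolyvaginBoundedDefectAtTwo` (stmt-BirchSwinnertonDyer-28083) ALONE implies its PARENT V1′∞
# `KolyvaginStrongNonzeroSystemAtTwo` (stmt-BirchSwinnertonDyer-27983) — the transport child U2 is redundant for the parent

Width seat `bsd-line-krr2-p2` g22 (ONE READER on LINE 17 `kolyvagin_swap`; route `KolyvaginRankRigidityAtTwo`);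
`--supports stmt-BirchSwinnertonDyer-28083` (helper).  THEOREMS ONLY; no definitions.  The composition step is the pen
`bsd-idea-1` g13's §8 of HOME `line17/DeepSeedPaddingAtTwo.lean` («U1 ALONE IMPLIES THE PARENT V1′∞ AND V1′θ»), re-typed against
the TREE: its level-lowering half is the landed converse `KolyvaginSwap.deepSeed_of_boundedDefect : U1 → DeepSeedAtTwo`
(`…KolyvaginSwapConverses`, p757564), and the remaining step is bookkeeping.

* `strongNonzeroSystem_of_deepSeed : DeepSeedAtTwo → KolyvaginStrongNonzeroSystemAtTwo` — given `θ, k`, keep the deep seed's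
  FIXED level `M := M₁ ≥ 1` and take its vertex at index `M* := θ·M₁ + k + M₁ ≥ M₁`: a depth-`r` conductor `n` with
  `θ·M₁ + k ≤ M* ≤ M(n)` and `c_{M₁}(n) ≠ 0`.
* `strongNonzeroSystem_of_boundedDefect : KolyvaginBoundedDefectAtTwo → KolyvaginStrongNonzeroSystemAtTwo` — compose with
  `deepSeed_of_boundedDefect`.
* `nonvanishingAtTwoFrameTheta_of_boundedDefect : KolyvaginBoundedDefectAtTwo → KolyvaginNonvanishingAtTwoFrameTheta` (V1′θ,
  stmt-BirchSwinnertonDyer-27219) — through the tree link `nonvanishingAtTwoFrameTheta_of_strongNonzeroSystem` (g8).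

READING (route-shape information for the planner/director, not a ruling): the gen-1 split of V1′∞ into U1 `KolyvaginBoundedDefectAtTwo`
∧ U2 `FullClassDeepeningAtTwo` (glue `StrongNonzeroSystemOfSeedTransport`, stmt-28085) has a REDUNDANT child: U2 (stmt-28084, landed
modulo Gross 1991 Prop. 3.7 (2) as `KolyvaginLowerBoundAtTwo.fullClassDeepeningAtTwo_of_prop37`) is not needed for the parent, so the
`hV1` binder of the route's `closes` follows from U1 with NO print fact (P372 stays on the `hV2` leg only).  The converse V1′∞ → U1 is
NOT claimed: V1′∞ lets the witness level `M` float with `(θ, k)`, U1 ≡ `DeepSeedAtTwo` pins it (`deepSeedAtTwo_iff_boundedDefect`).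
So the route's non-vanishing family is linearly ordered in the kernel: V1′θ ⇐ V1′∞ ⇐ U1 ⟺ S0⁺ (⟺ S0ʳ mod P372).
HONEST FRAMING: U1, S0⁺, V1′∞, V1′θ are all OPEN (forms of Kolyvagin's conjecture at `2`, beyond print); these are implications
between open statements; no stub of the registered skeleton is closed; no rung; **BSD is NOT proved.**
References (locators only): [cite: Kolyvagin1991MathAnn, §2 (2.1), Conj. 2.5] [cite: McCallumLMS1991, §4 (4)–(6), Lemma 4.6]
[cite: WZhang2014, Thm. 1.1 (the shape at p ≥ 5)].
Design: no definitions; default heartbeats; axioms `propext`, `Classical.choice`, `Quot.sound`.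
-/

set_option autoImplicit false
-- the Theorems namespace of this sub repeats the summit name by design (D-0017 nested layout)
set_option linter.dupNamespace false

noncomputable section

open Literature.NumberTheory.EllipticCurves
open Summit.BirchSwinnertonDyer.BirchSwinnertonDyer.Theses.KolyvaginRankRigidityAtTwo
open Summit.BirchSwinnertonDyer.BirchSwinnertonDyer.Theorems

namespace Summit.BirchSwinnertonDyer.BirchSwinnertonDyer.Theorems.KolyvaginAtTwo.KolyvaginSwap

/-- **S0⁺ ⟹ V1′∞**: a deep seed (ONE level `M₁ ≥ 1` with `c_{M₁}(n) ≠ 0` on depth-`r` conductors of unbounded index) is a strong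
non-zero system of depth `r`: for `θ, k` take `M := M₁` and the seed's vertex at index `M* := θ·M₁ + k + M₁`.  Both sides OPEN;
BSD is not proved. [cite: Kolyvagin1991MathAnn, §2 (2.1), Conj. 2.5] -/
theorem strongNonzeroSystem_of_deepSeed (h : DeepSeedAtTwo) : KolyvaginStrongNonzeroSystemAtTwo := by
  intro W _ _ hCM hred hsur K _ _ hK _ hHN hodd hne3 htor hH2 Dt β ι hβ
  obtain ⟨r, M₁, hM₁, hdeep⟩ := h W hCM hred hsur K hK hHN hodd hne3 htor hH2 Dt β ι hβ
  refine ⟨r, fun θ k ↦ ?_⟩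
  obtain ⟨n, d, hn, hr, hlev, hne⟩ := hdeep (θ * M₁ + k + M₁) (by omega)
  exact ⟨n, d, M₁, hn, hr, hM₁, le_trans (by exact_mod_cast Nat.le_add_right (θ * M₁ + k) M₁) hlev, hne⟩

/-- **U1 ⟹ V1′∞ WITHOUT U2** (kernel): the child `KolyvaginBoundedDefectAtTwo` ALONE implies its parent
`KolyvaginStrongNonzeroSystemAtTwo` — level lowering to the deep seed (`deepSeed_of_boundedDefect`, McCallum's level link read
downwards) and then `strongNonzeroSystem_of_deepSeed`; the transport child U2 `FullClassDeepeningAtTwo` and the print fact it is landed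
modulo are not used.  Both sides OPEN; closes nothing; BSD is NOT proved.
[cite: McCallumLMS1991, §4 (4)–(6), Lemma 4.6] [cite: Kolyvagin1991MathAnn, §2 (2.1), Conj. 2.5] -/
theorem strongNonzeroSystem_of_boundedDefect (h : KolyvaginBoundedDefectAtTwo) : KolyvaginStrongNonzeroSystemAtTwo :=
  strongNonzeroSystem_of_deepSeed (deepSeed_of_boundedDefect h)

/-- **U1 ⟹ V1′θ** `KolyvaginNonvanishingAtTwoFrameTheta` (stmt-BirchSwinnertonDyer-27219): through V1′∞ and the tree link
`KolyvaginAtTwo.nonvanishingAtTwoFrameTheta_of_strongNonzeroSystem` (forget the depth).  Both sides OPEN; BSD is not proved.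
[cite: Kolyvagin1991MathAnn, p. 259 (2.1)] -/
theorem nonvanishingAtTwoFrameTheta_of_boundedDefect (h : KolyvaginBoundedDefectAtTwo) :
    KolyvaginNonvanishingAtTwoFrameTheta :=
  KolyvaginAtTwo.nonvanishingAtTwoFrameTheta_of_strongNonzeroSystem (strongNonzeroSystem_of_boundedDefect h)

/-- **S0ʳ ⟹ V1′∞ modulo P372** (the line's input in room form reaches the parent through U1): CONDITIONAL on Gross 1991 Prop. 3.7 (2)
(`h37`, named Literature fact, unproved in the tree — it enters through LINE 17's swap composition only).  Both sides OPEN; BSD not proved.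
[cite: GrossLMS1991, §3 Prop. 3.7 (2)] [cite: Kolyvagin1991MathAnn, §2 Conj. 2.5 and the k(r) remark] -/
theorem strongNonzeroSystem_of_roomSeed_of_frobeniusCongruence (hS : KolyvaginRoomSeedAtTwo)
    (h37 : Literature.NumberTheory.EllipticCurves.GrossLMS1991.prop37_2_frobeniusCongruence) :
    KolyvaginStrongNonzeroSystemAtTwo :=
  strongNonzeroSystem_of_boundedDefect (kolyvaginBoundedDefectAtTwo_of_roomSeed_of_frobeniusCongruence hS h37)

end Summit.BirchSwinnertonDyer.BirchSwinnertonDyer.Theorems.KolyvaginAtTwo.KolyvaginSwap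

end
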